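import Summits.BirchSwinnertonDyer.BirchSwinnertonDyer.Theorems.ByReductionTypeAtTwoFineSelmerConjAAtTwoAdditivePotGoodNarrowRankCertificate316LayerOneResidues
import HarnessLib

/-!
# Route `ByReductionTypeAtTwo` (rung K4), crux C1″ `FineSelmerConjAAtTwoAdditivePotGood` (item stmt-BirchSwinnertonDyer-22615):
# THE LAYER-`1` FIELD `A₁ = ℚ(θ, √2)` OF THE CUBIC FIELD OF DISCRIMINANT `316`, PART D — the unit
# `u₊ = (−1 + 2θ + 2θ²) + √2(−1 + 2θ + θ²)` is TOTALLY POSITIVE, so `#(U⁺/U²)(A₁) ≥ 2` (KERNEL)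
# (a `--supports 22615` file; seat `bsd-2adic-k4-w1` GEN 11; sequel of `…316LayerOneResidues`; row `261648q1`, narrow-rank certificate one layer up)

HONEST FRAMING (cell `bsd-2adic`, D-0036/D-0054/D-0152): KERNEL theorems about ONE totally real sextic field; no elliptic curve, no named fact,
no `sorry`, no definition. Closes nothing at the `∀`-level; nothing booked; BSD is not proved by any of this.

THE CERTIFICATE.  Real places of `A₁`: `σ = (r_i, ±√2)`, `r₀ ≈ −1.81361 < r₁ ≈ 0.47068 < r₂ ≈ 2.34292` the roots of `X³ − X² − 4X + 2` (located to
`10⁻¹⁰`, `…316Cubic`), `√2` located to `10⁻¹⁰`; the six embeddings are told apart by their values on `θ`, `√2`.  `u₊ = −1 + 2θ + 2θ² + ξ(−2 + 3θ + 3θ²)`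
(`ξ = √2/θ`; `u₊ · (5 − 2ξ − 2θ + 3θξ − θ²ξ) = 1`) has the six values `≈ 0.0588, 3.84, 0.615, 0.154, 27.6, 1.69 > 0`, each decided by LINEAR
arithmetic (`linarith`) from interval bounds on the monomials `|x|, x², √2, √2|x|, √2x²` (`Ioo_mul_bounds`), the value at `σ` being an explicit
polynomial in `x = σ(θ)`, `y = σ(√2)` (`σ(ξ) = y(4 + x − x²)/2`, reduced with `x³ = x² + 4x − 2`, `y² = 2`); and `u₊` is not a square
(`…316LayerOneResidues`).  Hence `#(U⁺/U²)(A₁) ≥ 2` — the `hlow` input (`a = 1`) of k4-w2's door `index_range_pow_two_narrowClassGroup_eq_of_bounds_of_le`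
(p750350) for the rung `m = 1`; the sequel `…316LayerOneUnits` adds the `5 × 5` sign minor and `[Cl⁺(A₁) : Cl⁺(A₁)²] = 2`.

* `Ioo_mul_bounds` — interval product lemma; **`two_le_card_totPosUnitsModSq_adjoin_sup_layer_one_d316`** — `2 ≤ #(U⁺/U²)(A₁)`.

References: [FrohlichTaylor1990] Ch. V §1 (1.12); [Cohen1993] §4.1.3, §6.3; [Washington1997] §13.1.
-/

set_option autoImplicit false
-- sibling precedent: the directory name repeats the summit name
set_option linter.dupNamespace false

noncomputable section

open scoped Classical IntermediateField NumberField

namespace Summit.BirchSwinnertonDyer.BirchSwinnertonDyer.Theorems.AddKatoTwo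

open Polynomial IsDedekindDomain NumberField Field IntermediateField
  Literature.NumberTheory.EllipticCurves Literature.NumberTheory.EllipticCurves.ZpExtension
  Literature.NumberTheory.IwasawaTheory Literature.NumberTheory.NumberFields
  Literature.NumberTheory.GaloisRepresentations Literature.Geometry.Kaehler.ComplexTorus

/-- Interval product: `la < a < ua`, `lb < b < ub`, `0 ≤ la`, `0 ≤ lb` ⟹ `la·lb < ab < ua·ub`. [folklore] -/
theorem Ioo_mul_bounds {a b la ua lb ub : ℝ} (hla : 0 ≤ la) (hlb : 0 ≤ lb) (ha1 : la < a) (ha2 : a < ua)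
    (hb1 : lb < b) (hb2 : b < ub) : la * lb < a * b ∧ a * b < ua * ub :=
  ⟨mul_lt_mul'' ha1 hb1 hla hlb, mul_lt_mul'' ha2 hb2 (hla.trans ha1.le) (hlb.trans hb1.le)⟩

variable {θ : AlgebraicClosure ℚ}

set_option linter.unusedSimpArgs false in
set_option maxHeartbeats 1600000 in
/-- **`#(U⁺/U²)(ℚ(θ) ⊔ ℚ_1) ≥ 2` for `θ³ − θ² − 4θ + 2 = 0`**: the unit `u₊ = (−1 + 2θ + 2θ²) + √2(−1 + 2θ + θ²)` is totally positive (six located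
real embeddings, linear interval arithmetic) and not a square (`…316LayerOneResidues`). KERNEL. [cite: FrohlichTaylor1990, Ch. V §1 (1.12), p. 164]
[cite: Cohen1993, §4.1.3] [cite: Washington1997, §13.1] -/
theorem two_le_card_totPosUnitsModSq_adjoin_sup_layer_one_d316
    (hθ : aeval θ (Cubic.toPoly ⟨1, ((-1 : ℤ) : ℚ), ((-4 : ℤ) : ℚ), ((2 : ℤ) : ℚ)⟩) = 0) :
    haveI : FiniteDimensional ℚ ↥ℚ⟮θ⟯ :=
      IntermediateField.adjoin.finiteDimensional ⟨_, Cubic.monic_of_a_eq_one', by rwa [← aeval_def]⟩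
    haveI : FiniteDimensional ℚ ↥((CyclotomicZp.zpExtension 2).layer 1) := (CyclotomicZp.zpExtension 2).finiteDimensional_layer_holds 1
    haveI : NumberField ↥(ℚ⟮θ⟯ ⊔ (CyclotomicZp.zpExtension 2).layer 1) := NumberField.mk
    2 ≤ Nat.card (TotPosUnitsModSq ↥(ℚ⟮θ⟯ ⊔ (CyclotomicZp.zpExtension 2).layer 1)) := by
  haveI : FiniteDimensional ℚ ↥ℚ⟮θ⟯ :=
    IntermediateField.adjoin.finiteDimensional ⟨_, Cubic.monic_of_a_eq_one', by rwa [← aeval_def]⟩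
  haveI : FiniteDimensional ℚ ↥((CyclotomicZp.zpExtension 2).layer 1) := (CyclotomicZp.zpExtension 2).finiteDimensional_layer_holds 1
  haveI : NumberField ↥ℚ⟮θ⟯ := NumberField.mk
  haveI : NumberField ↥(ℚ⟮θ⟯ ⊔ (CyclotomicZp.zpExtension 2).layer 1) := NumberField.mk
  obtain ⟨hreal, hfinA, h3⟩ := layer_one_basics_d316 hθ
  haveI := hreal
  obtain ⟨t, ht, ht2⟩ := CyclotomicZp.exists_mem_layer_one_sq_eq_two_zpExtension
  have hKA : ℚ⟮θ⟯ ≤ ℚ⟮θ⟯ ⊔ (CyclotomicZp.zpExtension 2).layer 1 := le_sup_left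
  have htA : t ∈ ℚ⟮θ⟯ ⊔ (CyclotomicZp.zpExtension 2).layer 1 := (le_sup_right : (CyclotomicZp.zpExtension 2).layer 1 ≤ _) ht
  set t' : ↥(ℚ⟮θ⟯ ⊔ (CyclotomicZp.zpExtension 2).layer 1) := ⟨t, htA⟩ with ht'def
  set θ' : ↥(ℚ⟮θ⟯ ⊔ (CyclotomicZp.zpExtension 2).layer 1) := inclusion hKA (AdjoinSimple.gen ℚ θ) with hθ'def
  -- layer-0 embeddings and `√2`
  obtain ⟨ρ₀, ρ₁, ρ₂, x₀, x₁, x₂, hρ₀, hρ₁, hρ₂, hl₀, hu₀, hl₁, hu₁, hl₂, hu₂⟩ := exists_three_ringHom_adjoin_d316 hθ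
  have hs2l : ((14142135623 : ℝ) / 10000000000) < Real.sqrt 2 :=
    (Real.lt_sqrt (by norm_num)).mpr (by norm_num)
  have hs2u : Real.sqrt 2 < ((14142135624 : ℝ) / 10000000000) :=
    (Real.sqrt_lt' (by norm_num)).mpr (by norm_num)
  -- the integers of `…316LayerOneDyadic`
  obtain ⟨bA, xA, -, -, hbAval, -, hxθ, RbA, RxA, -, -, -, -, -, -, -, -, -, -⟩ := layer_one_dyadic_d316 hθ ht ht2
  have hθ'rel : θ' ^ 3 - θ' ^ 2 - 4 * θ' + 2 = 0 := by
    have h := congrArg (algebraMap (𝓞 ↥(ℚ⟮θ⟯ ⊔ (CyclotomicZp.zpExtension 2).layer 1)) ↥(ℚ⟮θ⟯ ⊔ (CyclotomicZp.zpExtension 2).layer 1)) RbA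
    simp only [map_add, map_sub, map_mul, map_pow, map_ofNat, map_zero] at h
    rw [← NumberField.RingOfIntegers.coe_eq_algebraMap, hbAval] at h; exact h
  -- values under an embedding `σ` with `σ θ' = x`, `σ t' = y`: `σ(b) = x`, `σ(ξ) = y(4 + x − x²)/2`
  have hval : ∀ (σ : ↥(ℚ⟮θ⟯ ⊔ (CyclotomicZp.zpExtension 2).layer 1) →+* ℝ) (x y : ℝ), σ θ' = x → σ t' = y →
      σ (algebraMap (𝓞 ↥(ℚ⟮θ⟯ ⊔ (CyclotomicZp.zpExtension 2).layer 1)) ↥(ℚ⟮θ⟯ ⊔ (CyclotomicZp.zpExtension 2).layer 1) bA) = x ∧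
      σ (algebraMap (𝓞 ↥(ℚ⟮θ⟯ ⊔ (CyclotomicZp.zpExtension 2).layer 1)) ↥(ℚ⟮θ⟯ ⊔ (CyclotomicZp.zpExtension 2).layer 1) xA) =
        y * (4 + x - x ^ 2) / 2 ∧ x ^ 3 - x ^ 2 - 4 * x + 2 = 0 := by
    intro σ x y hx hy
    have hb : σ (algebraMap _ _ bA) = x := by rw [← NumberField.RingOfIntegers.coe_eq_algebraMap, hbAval, hx]
    have hxrel : x ^ 3 - x ^ 2 - 4 * x + 2 = 0 := by
      have h := congrArg σ hθ'rel
      simp only [map_add, map_sub, map_mul, map_pow, map_ofNat, map_zero, hx] at h; exact h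
    refine ⟨hb, ?_, hxrel⟩
    have h1 : σ (algebraMap _ _ xA) * x = y := by
      rw [← hx, ← map_mul, ← NumberField.RingOfIntegers.coe_eq_algebraMap, hxθ]; exact hy
    have h2 : x * (4 + x - x ^ 2) = 2 := by linear_combination (-1 : ℝ) * hxrel
    calc σ (algebraMap _ _ xA) = σ (algebraMap _ _ xA) * (x * (4 + x - x ^ 2)) / 2 := by rw [h2]; ring
      _ = (σ (algebraMap _ _ xA) * x) * (4 + x - x ^ 2) / 2 := by ring
      _ = y * (4 + x - x ^ 2) / 2 := by rw [h1]
  -- the units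
  obtain ⟨-, -, -, -, -, -, -, -, -, hid₅, -, -, -, -⟩ := layer_one_ids_d316 bA xA RbA RxA
  set e₅ : (𝓞 ↥(ℚ⟮θ⟯ ⊔ (CyclotomicZp.zpExtension 2).layer 1))ˣ := Units.mkOfMulEqOne _ _ hid₅ with he₅def
  -- place σ₁: θ ↦ x₀, √2 ↦ +√2
  obtain ⟨σ₁, hσ₁K, hσ₁t⟩ := exists_ringHom_sup_layer_one_d316 hθ ht ht2 ρ₀ (Real.sqrt 2) (Or.inl rfl)
  have hσ₁θ : σ₁ θ' = x₀ := by rw [hθ'def, hσ₁K, hρ₀]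
  obtain ⟨hσ₁b, hσ₁x, hσ₁r⟩ := hval σ₁ x₀ (Real.sqrt 2) hσ₁θ hσ₁t
  have hysqσ₁ : (Real.sqrt 2) ^ 2 = 2 := by exact Real.sq_sqrt (by norm_num)
  -- place σ₂: θ ↦ x₀, √2 ↦ −√2
  obtain ⟨σ₂, hσ₂K, hσ₂t⟩ := exists_ringHom_sup_layer_one_d316 hθ ht ht2 ρ₀ (-Real.sqrt 2) (Or.inr rfl)
  have hσ₂θ : σ₂ θ' = x₀ := by rw [hθ'def, hσ₂K, hρ₀]
  obtain ⟨hσ₂b, hσ₂x, hσ₂r⟩ := hval σ₂ x₀ (-Real.sqrt 2) hσ₂θ hσ₂t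
  have hysqσ₂ : (-Real.sqrt 2) ^ 2 = 2 := by rw [neg_sq]; exact Real.sq_sqrt (by norm_num)
  -- place σ₃: θ ↦ x₁, √2 ↦ +√2
  obtain ⟨σ₃, hσ₃K, hσ₃t⟩ := exists_ringHom_sup_layer_one_d316 hθ ht ht2 ρ₁ (Real.sqrt 2) (Or.inl rfl)
  have hσ₃θ : σ₃ θ' = x₁ := by rw [hθ'def, hσ₃K, hρ₁]
  obtain ⟨hσ₃b, hσ₃x, hσ₃r⟩ := hval σ₃ x₁ (Real.sqrt 2) hσ₃θ hσ₃t
  have hysqσ₃ : (Real.sqrt 2) ^ 2 = 2 := by exact Real.sq_sqrt (by norm_num)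
  -- place σ₄: θ ↦ x₁, √2 ↦ −√2
  obtain ⟨σ₄, hσ₄K, hσ₄t⟩ := exists_ringHom_sup_layer_one_d316 hθ ht ht2 ρ₁ (-Real.sqrt 2) (Or.inr rfl)
  have hσ₄θ : σ₄ θ' = x₁ := by rw [hθ'def, hσ₄K, hρ₁]
  obtain ⟨hσ₄b, hσ₄x, hσ₄r⟩ := hval σ₄ x₁ (-Real.sqrt 2) hσ₄θ hσ₄t
  have hysqσ₄ : (-Real.sqrt 2) ^ 2 = 2 := by rw [neg_sq]; exact Real.sq_sqrt (by norm_num)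
  -- place σ₅: θ ↦ x₂, √2 ↦ +√2
  obtain ⟨σ₅, hσ₅K, hσ₅t⟩ := exists_ringHom_sup_layer_one_d316 hθ ht ht2 ρ₂ (Real.sqrt 2) (Or.inl rfl)
  have hσ₅θ : σ₅ θ' = x₂ := by rw [hθ'def, hσ₅K, hρ₂]
  obtain ⟨hσ₅b, hσ₅x, hσ₅r⟩ := hval σ₅ x₂ (Real.sqrt 2) hσ₅θ hσ₅t
  have hysqσ₅ : (Real.sqrt 2) ^ 2 = 2 := by exact Real.sq_sqrt (by norm_num)
  -- place σ₆: θ ↦ x₂, √2 ↦ −√2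
  obtain ⟨σ₆, hσ₆K, hσ₆t⟩ := exists_ringHom_sup_layer_one_d316 hθ ht ht2 ρ₂ (-Real.sqrt 2) (Or.inr rfl)
  have hσ₆θ : σ₆ θ' = x₂ := by rw [hθ'def, hσ₆K, hρ₂]
  obtain ⟨hσ₆b, hσ₆x, hσ₆r⟩ := hval σ₆ x₂ (-Real.sqrt 2) hσ₆θ hσ₆t
  have hysqσ₆ : (-Real.sqrt 2) ^ 2 = 2 := by rw [neg_sq]; exact Real.sq_sqrt (by norm_num)
  have hXl₀ : ((9068032513 : ℝ) / 5000000000) < -x₀ := by linarith [hu₀]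
  have hXu₀ : -x₀ < ((18136065027 : ℝ) / 10000000000) := by linarith [hl₀]
  obtain ⟨hXXl₀, hXXu₀⟩ := Ioo_mul_bounds (by norm_num) (by norm_num) hXl₀ hXu₀ hXl₀ hXu₀
  obtain ⟨hYXl₀, hYXu₀⟩ := Ioo_mul_bounds (by norm_num) (by norm_num) hs2l hs2u hXl₀ hXu₀
  obtain ⟨hYXXl₀, hYXXu₀⟩ := Ioo_mul_bounds (by norm_num) (by norm_num) hs2l hs2u hXXl₀ hXXu₀
  obtain ⟨hXXl₁, hXXu₁⟩ := Ioo_mul_bounds (by norm_num) (by norm_num) hl₁ hu₁ hl₁ hu₁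
  obtain ⟨hYXl₁, hYXu₁⟩ := Ioo_mul_bounds (by norm_num) (by norm_num) hs2l hs2u hl₁ hu₁
  obtain ⟨hYXXl₁, hYXXu₁⟩ := Ioo_mul_bounds (by norm_num) (by norm_num) hs2l hs2u hXXl₁ hXXu₁
  obtain ⟨hXXl₂, hXXu₂⟩ := Ioo_mul_bounds (by norm_num) (by norm_num) hl₂ hu₂ hl₂ hu₂
  obtain ⟨hYXl₂, hYXu₂⟩ := Ioo_mul_bounds (by norm_num) (by norm_num) hs2l hs2u hl₂ hu₂
  obtain ⟨hYXXl₂, hYXXu₂⟩ := Ioo_mul_bounds (by norm_num) (by norm_num) hs2l hs2u hXXl₂ hXXu₂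
  have se₅σ₁ : 0 < σ₁ ((e₅ : 𝓞 ↥(ℚ⟮θ⟯ ⊔ (CyclotomicZp.zpExtension 2).layer 1)) : ↥(ℚ⟮θ⟯ ⊔ (CyclotomicZp.zpExtension 2).layer 1)) := by
    have hv : σ₁ ((e₅ : 𝓞 ↥(ℚ⟮θ⟯ ⊔ (CyclotomicZp.zpExtension 2).layer 1)) : ↥(ℚ⟮θ⟯ ⊔ (CyclotomicZp.zpExtension 2).layer 1)) = (-1 : ℝ) + (-1 : ℝ) * Real.sqrt 2 + (-2 : ℝ) * (-x₀) + (-2 : ℝ) * (Real.sqrt 2 * (-x₀)) + (2 : ℝ) * ((-x₀) * (-x₀)) + (1 : ℝ) * (Real.sqrt 2 * ((-x₀) * (-x₀))) := by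
      rw [he₅def, Units.val_mkOfMulEqOne, NumberField.RingOfIntegers.coe_eq_algebraMap]
      simp only [map_add, map_sub, map_mul, map_pow, map_neg, map_one, map_ofNat, hσ₁b, hσ₁x]
      linear_combination (((-3 : ℝ) / 2) * (Real.sqrt 2) + ((-3 : ℝ) / 2) * x₀ * (Real.sqrt 2)) * hσ₁r + ((0 : ℝ)) * hysqσ₁
    rw [hv]; linarith [hXXl₀, hXXu₀, hYXl₀, hYXu₀, hYXXl₀, hYXXu₀, hs2l, hs2u, hXl₀, hXu₀]
  have se₅σ₂ : 0 < σ₂ ((e₅ : 𝓞 ↥(ℚ⟮θ⟯ ⊔ (CyclotomicZp.zpExtension 2).layer 1)) : ↥(ℚ⟮θ⟯ ⊔ (CyclotomicZp.zpExtension 2).layer 1)) := by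
    have hv : σ₂ ((e₅ : 𝓞 ↥(ℚ⟮θ⟯ ⊔ (CyclotomicZp.zpExtension 2).layer 1)) : ↥(ℚ⟮θ⟯ ⊔ (CyclotomicZp.zpExtension 2).layer 1)) = (-1 : ℝ) + (1 : ℝ) * Real.sqrt 2 + (-2 : ℝ) * (-x₀) + (2 : ℝ) * (Real.sqrt 2 * (-x₀)) + (2 : ℝ) * ((-x₀) * (-x₀)) + (-1 : ℝ) * (Real.sqrt 2 * ((-x₀) * (-x₀))) := by
      rw [he₅def, Units.val_mkOfMulEqOne, NumberField.RingOfIntegers.coe_eq_algebraMap]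
      simp only [map_add, map_sub, map_mul, map_pow, map_neg, map_one, map_ofNat, hσ₂b, hσ₂x]
      linear_combination (((-3 : ℝ) / 2) * (-Real.sqrt 2) + ((-3 : ℝ) / 2) * x₀ * (-Real.sqrt 2)) * hσ₂r + ((0 : ℝ)) * hysqσ₂
    rw [hv]; linarith [hXXl₀, hXXu₀, hYXl₀, hYXu₀, hYXXl₀, hYXXu₀, hs2l, hs2u, hXl₀, hXu₀]
  have se₅σ₃ : 0 < σ₃ ((e₅ : 𝓞 ↥(ℚ⟮θ⟯ ⊔ (CyclotomicZp.zpExtension 2).layer 1)) : ↥(ℚ⟮θ⟯ ⊔ (CyclotomicZp.zpExtension 2).layer 1)) := by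
    have hv : σ₃ ((e₅ : 𝓞 ↥(ℚ⟮θ⟯ ⊔ (CyclotomicZp.zpExtension 2).layer 1)) : ↥(ℚ⟮θ⟯ ⊔ (CyclotomicZp.zpExtension 2).layer 1)) = (-1 : ℝ) + (-1 : ℝ) * Real.sqrt 2 + (2 : ℝ) * x₁ + (2 : ℝ) * (Real.sqrt 2 * x₁) + (2 : ℝ) * (x₁ * x₁) + (1 : ℝ) * (Real.sqrt 2 * (x₁ * x₁)) := by
      rw [he₅def, Units.val_mkOfMulEqOne, NumberField.RingOfIntegers.coe_eq_algebraMap]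
      simp only [map_add, map_sub, map_mul, map_pow, map_neg, map_one, map_ofNat, hσ₃b, hσ₃x]
      linear_combination (((-3 : ℝ) / 2) * (Real.sqrt 2) + ((-3 : ℝ) / 2) * x₁ * (Real.sqrt 2)) * hσ₃r + ((0 : ℝ)) * hysqσ₃
    rw [hv]; linarith [hXXl₁, hXXu₁, hYXl₁, hYXu₁, hYXXl₁, hYXXu₁, hs2l, hs2u, hl₁, hu₁]
  have se₅σ₄ : 0 < σ₄ ((e₅ : 𝓞 ↥(ℚ⟮θ⟯ ⊔ (CyclotomicZp.zpExtension 2).layer 1)) : ↥(ℚ⟮θ⟯ ⊔ (CyclotomicZp.zpExtension 2).layer 1)) := by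
    have hv : σ₄ ((e₅ : 𝓞 ↥(ℚ⟮θ⟯ ⊔ (CyclotomicZp.zpExtension 2).layer 1)) : ↥(ℚ⟮θ⟯ ⊔ (CyclotomicZp.zpExtension 2).layer 1)) = (-1 : ℝ) + (1 : ℝ) * Real.sqrt 2 + (2 : ℝ) * x₁ + (-2 : ℝ) * (Real.sqrt 2 * x₁) + (2 : ℝ) * (x₁ * x₁) + (-1 : ℝ) * (Real.sqrt 2 * (x₁ * x₁)) := by
      rw [he₅def, Units.val_mkOfMulEqOne, NumberField.RingOfIntegers.coe_eq_algebraMap]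
      simp only [map_add, map_sub, map_mul, map_pow, map_neg, map_one, map_ofNat, hσ₄b, hσ₄x]
      linear_combination (((-3 : ℝ) / 2) * (-Real.sqrt 2) + ((-3 : ℝ) / 2) * x₁ * (-Real.sqrt 2)) * hσ₄r + ((0 : ℝ)) * hysqσ₄
    rw [hv]; linarith [hXXl₁, hXXu₁, hYXl₁, hYXu₁, hYXXl₁, hYXXu₁, hs2l, hs2u, hl₁, hu₁]
  have se₅σ₅ : 0 < σ₅ ((e₅ : 𝓞 ↥(ℚ⟮θ⟯ ⊔ (CyclotomicZp.zpExtension 2).layer 1)) : ↥(ℚ⟮θ⟯ ⊔ (CyclotomicZp.zpExtension 2).layer 1)) := by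
    have hv : σ₅ ((e₅ : 𝓞 ↥(ℚ⟮θ⟯ ⊔ (CyclotomicZp.zpExtension 2).layer 1)) : ↥(ℚ⟮θ⟯ ⊔ (CyclotomicZp.zpExtension 2).layer 1)) = (-1 : ℝ) + (-1 : ℝ) * Real.sqrt 2 + (2 : ℝ) * x₂ + (2 : ℝ) * (Real.sqrt 2 * x₂) + (2 : ℝ) * (x₂ * x₂) + (1 : ℝ) * (Real.sqrt 2 * (x₂ * x₂)) := by
      rw [he₅def, Units.val_mkOfMulEqOne, NumberField.RingOfIntegers.coe_eq_algebraMap]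
      simp only [map_add, map_sub, map_mul, map_pow, map_neg, map_one, map_ofNat, hσ₅b, hσ₅x]
      linear_combination (((-3 : ℝ) / 2) * (Real.sqrt 2) + ((-3 : ℝ) / 2) * x₂ * (Real.sqrt 2)) * hσ₅r + ((0 : ℝ)) * hysqσ₅
    rw [hv]; linarith [hXXl₂, hXXu₂, hYXl₂, hYXu₂, hYXXl₂, hYXXu₂, hs2l, hs2u, hl₂, hu₂]
  have se₅σ₆ : 0 < σ₆ ((e₅ : 𝓞 ↥(ℚ⟮θ⟯ ⊔ (CyclotomicZp.zpExtension 2).layer 1)) : ↥(ℚ⟮θ⟯ ⊔ (CyclotomicZp.zpExtension 2).layer 1)) := by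
    have hv : σ₆ ((e₅ : 𝓞 ↥(ℚ⟮θ⟯ ⊔ (CyclotomicZp.zpExtension 2).layer 1)) : ↥(ℚ⟮θ⟯ ⊔ (CyclotomicZp.zpExtension 2).layer 1)) = (-1 : ℝ) + (1 : ℝ) * Real.sqrt 2 + (2 : ℝ) * x₂ + (-2 : ℝ) * (Real.sqrt 2 * x₂) + (2 : ℝ) * (x₂ * x₂) + (-1 : ℝ) * (Real.sqrt 2 * (x₂ * x₂)) := by
      rw [he₅def, Units.val_mkOfMulEqOne, NumberField.RingOfIntegers.coe_eq_algebraMap]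
      simp only [map_add, map_sub, map_mul, map_pow, map_neg, map_one, map_ofNat, hσ₆b, hσ₆x]
      linear_combination (((-3 : ℝ) / 2) * (-Real.sqrt 2) + ((-3 : ℝ) / 2) * x₂ * (-Real.sqrt 2)) * hσ₆r + ((0 : ℝ)) * hysqσ₆
    rw [hv]; linarith [hXXl₂, hXXu₂, hYXl₂, hYXu₂, hYXXl₂, hYXXu₂, hs2l, hs2u, hl₂, hu₂]
  have hcardA : Fintype.card (↥(ℚ⟮θ⟯ ⊔ (CyclotomicZp.zpExtension 2).layer 1) →+* ℝ) = 6 := by rw [card_realEmbeddings, hfinA]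
  have hneθ : ∀ {φ ψ : ↥(ℚ⟮θ⟯ ⊔ (CyclotomicZp.zpExtension 2).layer 1) →+* ℝ}, φ θ' ≠ ψ θ' → φ ≠ ψ := by
    intro φ ψ h hφψ; exact h (by rw [hφψ])
  have hnet : ∀ {φ ψ : ↥(ℚ⟮θ⟯ ⊔ (CyclotomicZp.zpExtension 2).layer 1) →+* ℝ}, φ t' ≠ ψ t' → φ ≠ ψ := by
    intro φ ψ h hφψ; exact h (by rw [hφψ])
  have hss : Real.sqrt 2 ≠ -Real.sqrt 2 := by intro h; linarith [hs2l]
  have huniv : (Finset.univ : Finset (↥(ℚ⟮θ⟯ ⊔ (CyclotomicZp.zpExtension 2).layer 1) →+* ℝ)) = {σ₁, σ₂, σ₃, σ₄, σ₅, σ₆} := by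
    symm
    apply Finset.eq_of_subset_of_card_le (Finset.subset_univ _)
    rw [Finset.card_univ, hcardA]
    have h12 : σ₁ ≠ σ₂ := hnet (by rw [hσ₁t, hσ₂t]; exact hss)
    have h13 : σ₁ ≠ σ₃ := hneθ (by rw [hσ₁θ, hσ₃θ]; intro h; linarith)
    have h14 : σ₁ ≠ σ₄ := hneθ (by rw [hσ₁θ, hσ₄θ]; intro h; linarith)
    have h15 : σ₁ ≠ σ₅ := hneθ (by rw [hσ₁θ, hσ₅θ]; intro h; linarith)
    have h16 : σ₁ ≠ σ₆ := hneθ (by rw [hσ₁θ, hσ₆θ]; intro h; linarith)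
    have h23 : σ₂ ≠ σ₃ := hneθ (by rw [hσ₂θ, hσ₃θ]; intro h; linarith)
    have h24 : σ₂ ≠ σ₄ := hneθ (by rw [hσ₂θ, hσ₄θ]; intro h; linarith)
    have h25 : σ₂ ≠ σ₅ := hneθ (by rw [hσ₂θ, hσ₅θ]; intro h; linarith)
    have h26 : σ₂ ≠ σ₆ := hneθ (by rw [hσ₂θ, hσ₆θ]; intro h; linarith)
    have h34 : σ₃ ≠ σ₄ := hnet (by rw [hσ₃t, hσ₄t]; exact hss)
    have h35 : σ₃ ≠ σ₅ := hneθ (by rw [hσ₃θ, hσ₅θ]; intro h; linarith)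
    have h36 : σ₃ ≠ σ₆ := hneθ (by rw [hσ₃θ, hσ₆θ]; intro h; linarith)
    have h45 : σ₄ ≠ σ₅ := hneθ (by rw [hσ₄θ, hσ₅θ]; intro h; linarith)
    have h46 : σ₄ ≠ σ₆ := hneθ (by rw [hσ₄θ, hσ₆θ]; intro h; linarith)
    have h56 : σ₅ ≠ σ₆ := hnet (by rw [hσ₅t, hσ₆t]; exact hss)
    rw [Finset.card_insert_of_notMem (by simp [h12, h13, h14, h15, h16]), Finset.card_insert_of_notMem (by simp [h23, h24, h25, h26]),
      Finset.card_insert_of_notMem (by simp [h34, h35, h36]), Finset.card_insert_of_notMem (by simp [h45, h46]),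
      Finset.card_pair h56]
  have hpos : ∀ σ : ↥(ℚ⟮θ⟯ ⊔ (CyclotomicZp.zpExtension 2).layer 1) →+* ℝ,
      0 < σ ((e₅ : 𝓞 ↥(ℚ⟮θ⟯ ⊔ (CyclotomicZp.zpExtension 2).layer 1)) : ↥(ℚ⟮θ⟯ ⊔ (CyclotomicZp.zpExtension 2).layer 1)) := by
    intro σ
    have hσ : σ ∈ ({σ₁, σ₂, σ₃, σ₄, σ₅, σ₆} : Finset (↥(ℚ⟮θ⟯ ⊔ (CyclotomicZp.zpExtension 2).layer 1) →+* ℝ)) := huniv ▸ Finset.mem_univ σ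
    simp only [Finset.mem_insert, Finset.mem_singleton] at hσ
    rcases hσ with rfl | rfl | rfl | rfl | rfl | rfl
    · exact se₅σ₁
    · exact se₅σ₂
    · exact se₅σ₃
    · exact se₅σ₄
    · exact se₅σ₅
    · exact se₅σ₆
  have he₅val : ((e₅ : 𝓞 ↥(ℚ⟮θ⟯ ⊔ (CyclotomicZp.zpExtension 2).layer 1)) : ↥(ℚ⟮θ⟯ ⊔ (CyclotomicZp.zpExtension 2).layer 1)) =
      inclusion (le_sup_left : ℚ⟮θ⟯ ≤ ℚ⟮θ⟯ ⊔ (CyclotomicZp.zpExtension 2).layer 1)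
          (-1 + 2 * AdjoinSimple.gen ℚ θ + 2 * AdjoinSimple.gen ℚ θ ^ 2) +
        ⟨t, (le_sup_right : (CyclotomicZp.zpExtension 2).layer 1 ≤ _) ht⟩ *
          inclusion (le_sup_left : ℚ⟮θ⟯ ≤ ℚ⟮θ⟯ ⊔ (CyclotomicZp.zpExtension 2).layer 1)
            (-1 + 2 * AdjoinSimple.gen ℚ θ + AdjoinSimple.gen ℚ θ ^ 2) := by
    have hxθ' : algebraMap _ _ xA * θ' = t' := hxθ
    have hbA' : algebraMap (𝓞 ↥(ℚ⟮θ⟯ ⊔ (CyclotomicZp.zpExtension 2).layer 1)) ↥(ℚ⟮θ⟯ ⊔ (CyclotomicZp.zpExtension 2).layer 1) bA = θ' := hbAval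
    rw [he₅def, Units.val_mkOfMulEqOne, NumberField.RingOfIntegers.coe_eq_algebraMap]
    simp only [map_add, map_sub, map_mul, map_pow, map_neg, map_one, map_ofNat, hbA', ← hθ'def]
    change _ = _ + t' * _
    linear_combination (-1 + 2 * θ' + θ' ^ 2) * hxθ' +
      (-(algebraMap (𝓞 ↥(ℚ⟮θ⟯ ⊔ (CyclotomicZp.zpExtension 2).layer 1)) ↥(ℚ⟮θ⟯ ⊔ (CyclotomicZp.zpExtension 2).layer 1) xA)) * hθ'rel
  have hns := not_exists_unit_sq_eq_uplus_sup_layer_one_d316 hθ ht ht2 e₅ he₅val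
  exact two_le_card_totPosUnitsModSq_of_not_sq e₅ hpos hns

end Summit.BirchSwinnertonDyer.BirchSwinnertonDyer.Theorems.AddKatoTwo

end
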